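/- EXTRA WIDTH seat `ym-line-cbag-p1-w4` (g8), LINE 7 `GlueballBandRecursion`, in support of ⟨stmt-QuantumFields-22957⟩
`OneParticleBlochSymbolFamily`: the glue between a hopping KERNEL on `ℤ³` and the `2π`-periodic matrix symbol `B̃ : ℝ³ → Mat_n(ℂ)` that
`Band.EffectiveBlochSymbolFamily` quantifies over — periodicity, Hermitian symmetry, and "Fourier series at the lattice angles = discrete
Fourier transform of the periodised kernel", hence the trace formula in the def's own currency `Σ_p Re tr B̃(latticeAngle N p)^t`.
Route-independent; definition-free. -/
import Summits.QuantumFields.YangMills.Theorems.GlueballBandRecursionBlochReduction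

/-!
# Route `GlueballBandRecursion`: the periodic Bloch symbol of a finitely supported kernel on `ℤ³`

Third part of the S2 prefab (after `…BlochReduction.lean`, `…BlochCovariantFamily.lean`).  A cluster expansion delivers an effective
one-particle hopping kernel `J : ℤ³ → Mat_n(ℂ)` (here: finitely supported on `S`, hypothesis-bound); its symbol is the trigonometric polynomial
`B̃(q) = Σ_{d ∈ S} e^{−i q·d} J(d)` on `ℝ³`.  This file proves, DEFINITION-FREE:

* `exp_neg_mul_I_add_two_pi_mul_int` — `e^{−i(a + 2πm)} = e^{−ia}`; `periodic_symbol` — `B̃(q + 2πz) = B̃(q)` for `z ∈ ℤ³`, literally the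
  periodicity clause of `EffectiveBlochSymbolFamily`;
* `isHermitian_symbol_of_kernel` — `S = −S` and `J(−d) = J(d)ᴴ` ⇒ `B̃(q)` Hermitian for EVERY `q ∈ ℝ³` (the clause `∀ q, (Bt q).IsHermitian`);
* `exp_neg_latticeAngle_eq_star_char` — at a lattice angle `θ_p` the phase `e^{−iθ_p·d}` only sees `d mod N`: it equals `conj χ_p(r d)` for
  any reduction `r : ℤ³ → (Fin N)³` with `N ∣ d_i − (r d)_i`; hence `symbol_latticeAngle_eq_sum_kernel` and, grouping `S` by residues,
  `symbol_latticeAngle_eq_sum_periodised` — `B̃(θ_p) = Σ_x conj χ_p(x) • Jper(x)` with the periodised kernel `Jper x = Σ_{d ∈ S, r d = x} J d`,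
  entrywise `B̃(θ_p) j k = Σ_x Jper x j k conj χ_p(x)` = the symbol hypothesis `hB` of `…BlochReduction.lean`;
* `translate_of_kernel` — `M (x, j) (y, k) := Jper (x − y) j k` is translation-invariant; so `trace_pow_eq_sum_trace_symbol_latticeAngle_pow`:
  `tr M^t = Σ_p tr B̃(θ_p)^t` and its real part `re_trace_pow_eq_sum` — the right-hand currency of clause (P4) of the def.

Sources: folklore.  Deliberately NOT here: infinite-support kernels (`tsum`), decay ⇒ `C²` bounds (stub S3), anything spectral.

HONEST FRAMING.  Trigonometric-polynomial bookkeeping; item 22957, the rung and the Yang–Mills mass gap are NOT proved or advanced here.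
-/

set_option autoImplicit false

noncomputable section

open Finset Matrix Complex

namespace Summit.QuantumFields.YangMills.Theorems.GlueballBandRecursion.Bloch

open Summit.QuantumFields.YangMills.Theorems.GlueballBandRecursion.Band (coordsF coordsF_sub latticeAngle)

/-! ## §1 Phases -/

/-- `e^{−i(a + 2πm)} = e^{−ia}` for an integer `m`. [folklore] -/
theorem exp_neg_mul_I_add_two_pi_mul_int (a : ℝ) (m : ℤ) :
    Complex.exp (-(((a + 2 * Real.pi * m : ℝ) : ℂ) * Complex.I)) = Complex.exp (-(((a : ℝ) : ℂ) * Complex.I)) := by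
  push_cast
  rw [add_mul, neg_add, Complex.exp_add]
  have h : Complex.exp (-(2 * (Real.pi : ℂ) * (m : ℂ) * Complex.I)) = 1 := by
    rw [show -(2 * (Real.pi : ℂ) * (m : ℂ) * Complex.I) = ((-m : ℤ) : ℂ) * (2 * Real.pi * Complex.I) by push_cast; ring]
    exact Complex.exp_int_mul_two_pi_mul_I (-m)
  rw [h, mul_one]

/-- `conj e^{−ia} = e^{ia}` hence `e^{−i(−a)} = conj e^{−ia}` (real `a`). [folklore] -/
theorem exp_neg_neg_mul_I (a : ℝ) :
    Complex.exp (-(((-a : ℝ) : ℂ) * Complex.I)) = star (Complex.exp (-(((a : ℝ) : ℂ) * Complex.I))) := by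
  change _ = (starRingEnd ℂ) _
  rw [← Complex.exp_conj, map_neg, map_mul, Complex.conj_ofReal, Complex.conj_I]
  push_cast
  ring_nf

section Symbol

variable {n : ℕ} (S : Finset (Fin 3 → ℤ)) (J : (Fin 3 → ℤ) → Matrix (Fin n) (Fin n) ℂ)
  (Bt : (Fin 3 → ℝ) → Matrix (Fin n) (Fin n) ℂ)
  (hBt : ∀ q, Bt q = ∑ d ∈ S, Complex.exp (-(((∑ i : Fin 3, q i * (d i : ℝ) : ℝ) : ℂ) * Complex.I)) • J d)
include hBt

/-! ## §2 Periodicity and Hermitian symmetry of the symbol -/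

/-- **Periodicity** `B̃(q + 2πz) = B̃(q)` (`z ∈ ℤ³`) — the periodicity clause of `EffectiveBlochSymbolFamily`, verbatim. [folklore] -/
theorem periodic_symbol (q : Fin 3 → ℝ) (z : Fin 3 → ℤ) : Bt (fun i => q i + 2 * Real.pi * z i) = Bt q := by
  rw [hBt, hBt]
  refine Finset.sum_congr rfl fun d _ => ?_
  have h : (∑ i : Fin 3, (q i + 2 * Real.pi * z i) * (d i : ℝ)) = (∑ i : Fin 3, q i * (d i : ℝ)) + 2 * Real.pi * ((∑ i, z i * d i : ℤ)) := by
    push_cast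
    rw [Finset.mul_sum, ← Finset.sum_add_distrib]
    exact Finset.sum_congr rfl fun i _ => by ring
  rw [h, exp_neg_mul_I_add_two_pi_mul_int]

/-- **Hermitian symmetry**: if the support is symmetric and `J(−d) = J(d)ᴴ`, then `B̃(q)` is Hermitian for EVERY `q ∈ ℝ³`. [folklore] -/
theorem isHermitian_symbol_of_kernel (hS : ∀ d ∈ S, -d ∈ S) (hJ : ∀ d ∈ S, J (-d) = (J d)ᴴ) (q : Fin 3 → ℝ) : (Bt q).IsHermitian := by
  rw [Matrix.IsHermitian, hBt, Matrix.conjTranspose_sum]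
  simp_rw [Matrix.conjTranspose_smul]
  refine Finset.sum_nbij' (fun d => -d) (fun d => -d) hS hS (fun d _ => neg_neg d) (fun d _ => neg_neg d) fun d hd => ?_
  rw [hJ d hd]
  congr 1
  have h : (∑ i : Fin 3, q i * ((-d) i : ℝ)) = -(∑ i : Fin 3, q i * (d i : ℝ)) := by
    rw [← Finset.sum_neg_distrib]
    exact Finset.sum_congr rfl fun i _ => by rw [Pi.neg_apply]; push_cast; ring
  rw [h, exp_neg_neg_mul_I]

/-! ## §3 At the lattice angles: the symbol is the DFT of the periodised kernel -/

variable {N : ℕ} [NeZero N]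
  (χ : (Fin N × Fin N × Fin N) → (Fin N × Fin N × Fin N) → ℂ)
  (hχ : ∀ p x, χ p x = Complex.exp (((∑ i : Fin 3, latticeAngle N p i * ((coordsF x i).val : ℝ) : ℝ) : ℂ) * Complex.I))
  (r : (Fin 3 → ℤ) → Fin N × Fin N × Fin N) (hr : ∀ d i, (N : ℤ) ∣ d i - ((coordsF (r d) i).val : ℤ))

omit hBt in
include hχ hr in
/-- **A lattice-angle phase only sees the displacement mod `N`**: `e^{−iθ_p·d} = conj χ_p(r d)` whenever `d ≡ r d (mod N)` coordinatewise.
[folklore] -/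
theorem exp_neg_latticeAngle_eq_star_char (p : Fin N × Fin N × Fin N) (d : Fin 3 → ℤ) :
    Complex.exp (-(((∑ i : Fin 3, latticeAngle N p i * (d i : ℝ) : ℝ) : ℂ) * Complex.I)) = star (χ p (r d)) := by
  have hNr : (N : ℝ) ≠ 0 := Nat.cast_ne_zero.2 (NeZero.ne N)
  have hx : star (χ p (r d)) =
      Complex.exp (-(((∑ i : Fin 3, latticeAngle N p i * ((coordsF (r d) i).val : ℝ) : ℝ) : ℂ) * Complex.I)) := by
    rw [hχ]
    change (starRingEnd ℂ) _ = _
    rw [← Complex.exp_conj, map_mul, Complex.conj_ofReal, Complex.conj_I, mul_neg]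
  rw [hx]
  choose c hc using fun i => hr d i
  have h : (∑ i : Fin 3, latticeAngle N p i * (d i : ℝ)) =
      (∑ i : Fin 3, latticeAngle N p i * ((coordsF (r d) i).val : ℝ)) + 2 * Real.pi * ((∑ i, ((coordsF p i).val : ℤ) * c i : ℤ)) := by
    push_cast
    rw [Finset.mul_sum, ← Finset.sum_add_distrib]
    refine Finset.sum_congr rfl fun i _ => ?_
    have hdi : (d i : ℝ) = ((coordsF (r d) i).val : ℝ) + (N : ℝ) * (c i : ℝ) := by
      have := hc i
      have h' : (d i : ℤ) = ((coordsF (r d) i).val : ℤ) + N * c i := by linarith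
      exact_mod_cast h'
    rw [hdi, latticeAngle]
    field_simp
  rw [h, exp_neg_mul_I_add_two_pi_mul_int]

include hχ hr in
/-- The symbol at a lattice angle, kernel form: `B̃(θ_p) = Σ_{d ∈ S} conj χ_p(r d) • J d`. [folklore] -/
theorem symbol_latticeAngle_eq_sum_kernel (p : Fin N × Fin N × Fin N) :
    Bt (latticeAngle N p) = ∑ d ∈ S, star (χ p (r d)) • J d := by
  rw [hBt]
  exact Finset.sum_congr rfl fun d _ => by rw [exp_neg_latticeAngle_eq_star_char χ hχ r hr]

variable (Jper : (Fin N × Fin N × Fin N) → Matrix (Fin n) (Fin n) ℂ) (hJper : ∀ x, Jper x = ∑ d ∈ S with r d = x, J d)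

include hχ hr hJper in
/-- **The symbol at a lattice angle is the DFT of the periodised kernel**: `B̃(θ_p) = Σ_x conj χ_p(x) • Jper x` with
`Jper x = Σ_{d ∈ S, r d = x} J d`. [folklore] -/
theorem symbol_latticeAngle_eq_sum_periodised (p : Fin N × Fin N × Fin N) :
    Bt (latticeAngle N p) = ∑ x, star (χ p x) • Jper x := by
  classical
  rw [symbol_latticeAngle_eq_sum_kernel S J Bt hBt χ hχ r hr,
    ← Finset.sum_fiberwise_of_maps_to (t := Finset.univ) (fun d (_ : d ∈ S) => Finset.mem_univ (r d))
      (fun d => star (χ p (r d)) • J d)]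
  refine Finset.sum_congr rfl fun x _ => ?_
  rw [hJper, Finset.smul_sum]
  -- inside the fibre `r d = x` the phase is `conj χ_p(x)`
  refine Finset.sum_congr rfl fun d hd => ?_
  rw [(Finset.mem_filter.1 hd).2]

include hχ hr hJper in
/-- Entrywise: `B̃(θ_p) j k = Σ_x Jper x j k · conj χ_p(x)` — exactly the symbol hypothesis `hB` of `…BlochReduction.lean` for the
translation-invariant matrix of the periodised kernel. [folklore] -/
theorem symbol_latticeAngle_apply (p : Fin N × Fin N × Fin N) (j k : Fin n) :
    Bt (latticeAngle N p) j k = ∑ x, Jper x j k * star (χ p x) := by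
  rw [symbol_latticeAngle_eq_sum_periodised S J Bt hBt χ hχ r hr Jper hJper, Matrix.sum_apply]
  exact Finset.sum_congr rfl fun x _ => by rw [Matrix.smul_apply, smul_eq_mul, mul_comm]

end Symbol

/-! ## §4 The translation-invariant matrix of a periodised kernel and the trace formula in the def's currency -/

section Trace

variable {N : ℕ} [NeZero N] {n : ℕ}
  (χ : (Fin N × Fin N × Fin N) → (Fin N × Fin N × Fin N) → ℂ)
  (hχ : ∀ p x, χ p x = Complex.exp (((∑ i : Fin 3, latticeAngle N p i * ((coordsF x i).val : ℝ) : ℝ) : ℂ) * Complex.I))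
  (Jper : (Fin N × Fin N × Fin N) → Matrix (Fin n) (Fin n) ℂ)
  (M : Matrix ((Fin N × Fin N × Fin N) × Fin n) ((Fin N × Fin N × Fin N) × Fin n) ℂ)
  (hMJ : ∀ x y j k, M (x, j) (y, k) = Jper (x - y) j k)
  (Bt : (Fin 3 → ℝ) → Matrix (Fin n) (Fin n) ℂ)
  (hBlat : ∀ p j k, Bt (latticeAngle N p) j k = ∑ x, Jper x j k * star (χ p x))

include hMJ in
/-- A kernel matrix `M (x, j) (y, k) = Jper (x − y) j k` is translation-invariant. [folklore] -/
theorem translate_of_kernel (a x y : Fin N × Fin N × Fin N) (j k : Fin n) : M (x + a, j) (y + a, k) = M (x, j) (y, k) := by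
  rw [hMJ, hMJ, add_sub_add_right_eq_sub]

include hχ hMJ hBlat in
/-- **Trace formula in the def's currency**: `tr M^t = Σ_p tr B̃(θ_p)^t` for the kernel matrix of `Jper` and any symbol `B̃` whose values at
the lattice angles are the DFT of `Jper` (e.g. by `symbol_latticeAngle_apply`). [folklore] -/
theorem trace_pow_eq_sum_trace_symbol_latticeAngle_pow (t : ℕ) :
    (M ^ t).trace = ∑ p : Fin N × Fin N × Fin N, (Bt (latticeAngle N p) ^ t).trace := by
  classical
  obtain ⟨F, hF⟩ : ∃ F : Matrix ((Fin N × Fin N × Fin N) × Fin n) (Fin n × (Fin N × Fin N × Fin N)) ℂ,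
      ∀ x j k p, F (x, j) (k, p) = if j = k then χ p x else 0 :=
    ⟨Matrix.of fun xj kp => if xj.2 = kp.1 then χ kp.2 xj.1 else 0, fun _ _ _ _ => rfl⟩
  have hB : ∀ p j k, (fun p => Bt (latticeAngle N p)) p j k = ∑ x, M (x, j) (0, k) * star (χ p x) := fun p j k => by
    simp only [hBlat, hMJ, sub_zero]
  exact trace_pow_eq_sum_trace_symbol_pow χ hχ M (translate_of_kernel Jper M hMJ) (fun p => Bt (latticeAngle N p)) hB F hF t

include hχ hMJ hBlat in
/-- Real parts: `Re tr M^t = Σ_p Re tr B̃(θ_p)^t` — the right-hand side of clause (P4) of `EffectiveBlochSymbolFamily`. [folklore] -/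
theorem re_trace_pow_eq_sum (t : ℕ) :
    ((M ^ t).trace).re = ∑ p : Fin N × Fin N × Fin N, ((Bt (latticeAngle N p) ^ t).trace).re := by
  rw [trace_pow_eq_sum_trace_symbol_latticeAngle_pow χ hχ Jper M hMJ Bt hBlat t, Complex.re_sum]

include hχ hMJ hBlat in
/-- Hermitian symmetry at the lattice angles from the kernel: `Jper (−x) = (Jper x)ᴴ ⇒ B̃(θ_p)` Hermitian (via `isHermitian_symbol`). [folklore] -/
theorem isHermitian_symbol_latticeAngle (hJ : ∀ x, Jper (-x) = (Jper x)ᴴ) (p : Fin N × Fin N × Fin N) :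
    (Bt (latticeAngle N p)).IsHermitian := by
  have hB : ∀ p j k, (fun p => Bt (latticeAngle N p)) p j k = ∑ x, M (x, j) (0, k) * star (χ p x) := fun p j k => by
    simp only [hBlat, hMJ, sub_zero]
  have hMh : M.IsHermitian := by
    refine Matrix.IsHermitian.ext fun i l => ?_
    obtain ⟨x, j⟩ := i
    obtain ⟨y, k⟩ := l
    rw [hMJ, hMJ, ← neg_sub x y, hJ, Matrix.conjTranspose_apply, star_star]
  exact isHermitian_symbol χ hχ M (translate_of_kernel Jper M hMJ) (fun p => Bt (latticeAngle N p)) hB hMh p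

end Trace

end Summit.QuantumFields.YangMills.Theorems.GlueballBandRecursion.Bloch

end
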